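/- WIDTH SEAT `ym-line-cbag-p1-w3` (prover-ym-line-cbag-p1-w3-g12-0), route `EguchiKawaiDirectionLadder` (ideator ym-idea-2,
LINE 8), crux `TripleSmallBallMargin` (stmt-QuantumFields-27724), LEAD g24's v7 architecture, stub S7 (E_rob): the VOLUMETRIC
NET of a ball in a finite-dimensional real normed space (packing against an additive Haar measure), the second finite net of
the rank-robust reduction `EguchiKawaiDirectionLadderRankRobustReduction.lean` (the first is the Grassmannian net of stub S6).
ROUTE-INDEPENDENT.  Nothing here bears on the Yang–Mills mass gap (barrier-ledger line onto `EguchiKawaiBreakdown`). -/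
import Mathlib.MeasureTheory.Measure.Lebesgue.EqHaar
import Mathlib.Algebra.Order.Floor.Defs
import HarnessLib

/-!
# Volumetric nets of balls in finite-dimensional normed spaces

For a finite-dimensional real normed space `E` of dimension `d`, radius `R ≥ 0` and mesh `δ > 0`:

* `card_le_of_separated` — a finite `δ`-separated subset of the closed `R`-ball has at most `(1 + 2R/δ)^d` points
  (the `δ/2`-balls around its points are disjoint and lie in the `(R + δ/2)`-ball; compare volumes with an additive
  Haar measure, `Measure.addHaar_ball_of_pos`);
* `exists_net` — hence (a separated subset of maximal cardinality is a net) there is a finite `δ`-NET of the closed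
  `R`-ball, made of points of the ball, with at most `(1 + 2R/δ)^d` points.

The point is the ABSENCE of any dimensional factor in the ratio `R/δ` (a coordinate grid would give `(√d·R/δ)^d`,
cf. `Literature.Analysis.Convexity.exists_net_closedBall`); with `d ∝ N²` this is what keeps the constants of the
line `e^{O(N²)}`.  All [folklore] (e.g. Vershynin, *High-dimensional probability*, Cor. 4.2.13).
-/

set_option autoImplicit false

noncomputable section

open MeasureTheory Metric Module

namespace Summit.QuantumFields.YangMills.Theorems.EguchiKawaiDirectionLadder.BallNet

variable {E : Type*} [NormedAddCommGroup E] [NormedSpace ℝ E] [FiniteDimensional ℝ E]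

/-- **Packing bound.** A finite subset of the closed `R`-ball whose points are pairwise more than `δ` apart has at most
`(1 + 2R/δ)^{dim E}` points. [folklore] -/
theorem card_le_of_separated {R δ : ℝ} (hR : 0 ≤ R) (hδ : 0 < δ) (S : Finset E) (hS : ∀ x ∈ S, ‖x‖ ≤ R)
    (hsep : ∀ x ∈ S, ∀ y ∈ S, x ≠ y → δ < ‖x - y‖) :
    (S.card : ℝ) ≤ (1 + 2 * R / δ) ^ finrank ℝ E := by
  classical
  borelize E
  set μ : Measure E := Measure.addHaar with hμ
  set d : ℕ := finrank ℝ E with hd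
  -- the small balls
  set B : E → Set E := fun x => ball x (δ / 2) with hB
  have hδ2 : 0 < δ / 2 := by positivity
  have hBmeas : ∀ x, MeasurableSet (B x) := fun x => measurableSet_ball
  have hdisj : Set.PairwiseDisjoint (↑S : Set E) B := by
    intro x hx y hy hxy
    rw [Function.onFun, Set.disjoint_left]
    intro z hzx hzy
    rw [hB, mem_ball] at hzx hzy
    have h1 : ‖x - y‖ ≤ dist z x + dist z y := by
      rw [← dist_eq_norm]; exact dist_triangle_left x y z
    have h2 := hsep x hx y hy hxy
    linarith
  have hsub : (⋃ x ∈ S, B x) ⊆ ball (0 : E) (R + δ / 2) := by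
    intro z hz
    obtain ⟨x, hx, hzx⟩ := Set.mem_iUnion₂.1 hz
    rw [hB, mem_ball] at hzx
    rw [mem_ball, dist_zero_right]
    have hxR := hS x hx
    calc ‖z‖ = ‖(z - x) + x‖ := by rw [sub_add_cancel]
      _ ≤ ‖z - x‖ + ‖x‖ := norm_add_le _ _
      _ < δ / 2 + R := by rw [← dist_eq_norm]; linarith
      _ = R + δ / 2 := by ring
  -- volumes
  have hvol : ∀ (x : E) {ρ : ℝ}, 0 < ρ → μ (ball x ρ) = ENNReal.ofReal (ρ ^ d) * μ (ball 0 1) :=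
    fun x ρ hρ => Measure.addHaar_ball_of_pos μ x hρ
  have h1pos : 0 < μ (ball (0 : E) 1) := measure_ball_pos μ 0 one_pos
  have h1top : μ (ball (0 : E) 1) < ⊤ := measure_ball_lt_top
  have hsum : (S.card : ENNReal) * (ENNReal.ofReal ((δ / 2) ^ d) * μ (ball 0 1)) ≤
      ENNReal.ofReal ((R + δ / 2) ^ d) * μ (ball 0 1) := by
    calc (S.card : ENNReal) * (ENNReal.ofReal ((δ / 2) ^ d) * μ (ball 0 1))
        = ∑ x ∈ S, μ (B x) := by
          rw [Finset.sum_congr rfl fun x _ => hvol x hδ2, Finset.sum_const, nsmul_eq_mul]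
      _ = μ (⋃ x ∈ S, B x) := (measure_biUnion_finset hdisj fun x _ => hBmeas x).symm
      _ ≤ μ (ball (0 : E) (R + δ / 2)) := measure_mono hsub
      _ = ENNReal.ofReal ((R + δ / 2) ^ d) * μ (ball 0 1) := hvol 0 (by positivity)
  -- cancel `μ (ball 0 1)` and pass to `ℝ`
  have hsum' : (S.card : ENNReal) * ENNReal.ofReal ((δ / 2) ^ d) ≤ ENNReal.ofReal ((R + δ / 2) ^ d) := by
    rw [← mul_assoc] at hsum
    exact (ENNReal.mul_le_mul_iff_left h1pos.ne' h1top.ne).1 hsum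
  have hreal : (S.card : ℝ) * (δ / 2) ^ d ≤ (R + δ / 2) ^ d := by
    have h := hsum'
    rw [← ENNReal.ofReal_natCast, ← ENNReal.ofReal_mul (Nat.cast_nonneg _)] at h
    exact (ENNReal.ofReal_le_ofReal_iff (by positivity)).1 h
  have hpow : 0 < (δ / 2) ^ d := by positivity
  rw [← le_div_iff₀ hpow] at hreal
  refine hreal.trans (le_of_eq ?_)
  rw [← div_pow]
  congr 1
  field_simp
  ring

/-- **Volumetric net.** For `R ≥ 0` and `δ > 0` there is a finite set of points of the closed `R`-ball, at most
`(1 + 2R/δ)^{dim E}` of them, within `δ` of every point of the closed `R`-ball (a `δ`-separated subset of maximal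
cardinality, which exists by `card_le_of_separated`, is such a net). [folklore] -/
theorem exists_net {R δ : ℝ} (hR : 0 ≤ R) (hδ : 0 < δ) :
    ∃ S : Finset E, (S.card : ℝ) ≤ (1 + 2 * R / δ) ^ finrank ℝ E ∧ (∀ y ∈ S, ‖y‖ ≤ R) ∧
      ∀ x : E, ‖x‖ ≤ R → ∃ y ∈ S, ‖x - y‖ ≤ δ := by
  classical
  let good : Finset E → Prop := fun S =>
    (∀ y ∈ S, ‖y‖ ≤ R) ∧ ∀ x ∈ S, ∀ y ∈ S, x ≠ y → δ < ‖x - y‖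
  let Pk : ℕ → Prop := fun k => ∃ S, good S ∧ S.card = k
  set Bd : ℕ := ⌊(1 + 2 * R / δ) ^ finrank ℝ E⌋₊ with hBd
  have hcard : ∀ S, good S → (S.card : ℝ) ≤ (1 + 2 * R / δ) ^ finrank ℝ E :=
    fun S hS => card_le_of_separated hR hδ S hS.1 hS.2
  have hcardN : ∀ S, good S → S.card ≤ Bd := fun S hS => Nat.le_floor (hcard S hS)
  have hP0 : Pk 0 := ⟨∅, ⟨by simp, by simp⟩, rfl⟩
  set k₀ := Nat.findGreatest Pk Bd with hk₀
  obtain ⟨S₀, hgood, hcardS₀⟩ : Pk k₀ := Nat.findGreatest_spec (Nat.zero_le Bd) hP0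
  refine ⟨S₀, hcard S₀ hgood, hgood.1, fun x hx => ?_⟩
  by_contra hcon
  push Not at hcon
  have hxS : x ∉ S₀ := by
    intro hxS
    have := hcon x hxS
    rw [sub_self, norm_zero] at this
    linarith
  have hgood' : good (insert x S₀) := by
    refine ⟨?_, ?_⟩
    · intro y hy
      rw [Finset.mem_insert] at hy
      rcases hy with hy | hy
      · rw [hy]; exact hx
      · exact hgood.1 y hy
    · intro a ha b hb hab
      rw [Finset.mem_insert] at ha hb
      rcases ha with ha | ha
      · rcases hb with hb | hb
        · exact absurd (ha.trans hb.symm) hab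
        · rw [ha]; exact hcon b hb
      · rcases hb with hb | hb
        · rw [hb, norm_sub_rev]; exact hcon a ha
        · exact hgood.2 a ha b hb hab
  have hP1 : Pk (k₀ + 1) := ⟨insert x S₀, hgood', by rw [Finset.card_insert_of_notMem hxS, hcardS₀]⟩
  have hle : k₀ + 1 ≤ Bd := by
    have := hcardN _ hgood'
    rwa [Finset.card_insert_of_notMem hxS, hcardS₀] at this
  exact Nat.findGreatest_is_greatest (Nat.lt_succ_self k₀) hle hP1

end Summit.QuantumFields.YangMills.Theorems.EguchiKawaiDirectionLadder.BallNet

end
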